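import Summits.Ventures.HodgeRepro2.A1ExteriorBaseChange

/-!
# T6-A3 — base change of exterior algebras (the carrier-free ℚ → ℂ toolkit of the A3 glue)

Tier 6 (README §10), sub-goal A3, seat t6-p3; proof lane (carrier-free).  The interface of record
(`T6Interface.lean` v0, lead) carries the cohomology of the corner product `B` as the RATIONAL
exterior algebra `HB = ⋀_ℚ H¹(B, ℚ)` with ℚ-valued data (`∫_B`, `∫_{B×B}`, `m^*`, the Pontryagin
product), while the pairing identity of TIER4 §A5 is a computation in the complex eigenbasis
(`T6A3Pairing`, over `HBC = ⋀_ℂ H¹(B, ℂ)`).  This file provides the base change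
`S ⊗[R] ⋀_R V ≃ₐ[S] ⋀_S (S ⊗[R] V)` (Mathlib's `CliffordAlgebra.equivBaseChange` at the zero form)
together with the extension lemmas the A3 glue uses: a linear functional / an identity of
`R`-linear maps on `⋀_R V` extends uniquely to `⋀_S (S ⊗ V)` (`IsBaseChange.lift` / `algHom_ext`),
the coefficient extension is graded, and the graded tensor product `⋀ ᵍ⊗ ⋀` base-changes
compatibly with the two inclusions and with the coproduct `m^*`.  The interface-level
definitions over `(D : TransferShadow F)` (`intBC D`, `intBBC D`, `copC D`, `pontC D` and the
transported identities, lead's ruling STATUS l. 4259) live in `T6A3BaseChange.lean`, which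
instantiates this file at `R = ℚ`, `S = ℂ`, `V = H¹(B, ℚ)`.

Nothing here is a display; everything is Mathlib linear algebra (p7's accepted
`A1ExteriorBaseChange` is imported for its scalar-tower instance on exterior algebras).
-/

open scoped TensorProduct

namespace Summit.Ventures.HodgeRepro2.T6.A3ExtBC

section ExteriorBaseChange

variable {R : Type*} [CommRing R] [Invertible (2 : R)]
variable {S : Type*} [CommRing S] [Algebra R S]
variable {V : Type*} [AddCommGroup V] [Module R V]

/-- The zero quadratic form base-changes to the zero quadratic form. -/
theorem baseChange_zero : (0 : QuadraticForm R V).baseChange S = 0 := by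
  ext m
  simp [QuadraticForm.baseChange_tmul]

variable (R S V) in
/-- The tautological isometry between the base-changed zero form and the zero form on `S ⊗[R] V`. -/
def zeroIsometry :
    ((0 : QuadraticForm R V).baseChange S).IsometryEquiv (0 : QuadraticForm S (S ⊗[R] V)) :=
  { LinearEquiv.refl S (S ⊗[R] V) with
    map_app' := fun m => by simp [baseChange_zero] }

variable (R S V) in
/-- Base change of the exterior algebra: `⋀_S (S ⊗[R] V) ≃ₐ[S] S ⊗[R] ⋀_R V`
(`CliffordAlgebra.equivBaseChange` at the zero form). -/
noncomputable def extBC : ExteriorAlgebra S (S ⊗[R] V) ≃ₐ[S] S ⊗[R] ExteriorAlgebra R V :=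
  (CliffordAlgebra.equivOfIsometry (zeroIsometry R S V).symm).trans
    (CliffordAlgebra.equivBaseChange S (0 : QuadraticForm R V))

/-- `extBC (ι (s ⊗ v)) = s ⊗ ι v`. -/
theorem extBC_ι (s : S) (v : V) :
    extBC R S V (ExteriorAlgebra.ι S (s ⊗ₜ[R] v)) = s ⊗ₜ[R] ExteriorAlgebra.ι R v := by
  unfold extBC
  rw [AlgEquiv.trans_apply, CliffordAlgebra.equivOfIsometry_apply]
  have h : (CliffordAlgebra.map (zeroIsometry R S V).symm.toIsometry)
      (ExteriorAlgebra.ι S (s ⊗ₜ[R] v)) =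
      CliffordAlgebra.ι ((0 : QuadraticForm R V).baseChange S) (s ⊗ₜ[R] v) := by
    rw [ExteriorAlgebra.ι]
    exact CliffordAlgebra.map_apply_ι _ _
  rw [h, CliffordAlgebra.equivBaseChange_apply, CliffordAlgebra.toBaseChange_ι]

/-- `extBC.symm (s ⊗ ι v) = ι (s ⊗ v)`. -/
theorem extBC_symm_tmul_ι (s : S) (v : V) :
    (extBC R S V).symm (s ⊗ₜ[R] ExteriorAlgebra.ι R v) = ExteriorAlgebra.ι S (s ⊗ₜ[R] v) := by
  rw [AlgEquiv.symm_apply_eq, extBC_ι]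

variable (R S V) in
/-- The coefficient extension `⋀_R V →ₐ[R] ⋀_S (S ⊗[R] V)`, `a ↦ extBC⁻¹ (1 ⊗ a)`
(`ι v ↦ ι (1 ⊗ v)`). -/
noncomputable def ofR : ExteriorAlgebra R V →ₐ[R] ExteriorAlgebra S (S ⊗[R] V) :=
  ((extBC R S V).symm.toAlgHom.restrictScalars R).comp Algebra.TensorProduct.includeRight

/-- `ofR a = extBC.symm (1 ⊗ a)`. -/
theorem ofR_apply (a : ExteriorAlgebra R V) : ofR R S V a = (extBC R S V).symm (1 ⊗ₜ[R] a) := by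
  simp only [ofR, AlgHom.comp_apply, AlgHom.coe_restrictScalars',
    Algebra.TensorProduct.includeRight_apply]
  rfl

/-- `ofR (ι v) = ι (1 ⊗ v)`. -/
theorem ofR_ι (v : V) : ofR R S V (ExteriorAlgebra.ι R v) = ExteriorAlgebra.ι S (1 ⊗ₜ[R] v) := by
  rw [ofR_apply, extBC_symm_tmul_ι]

/-- `⋀_S (S ⊗ V)` is the base change of `⋀_R V` along `ofR` (Mathlib's `IsBaseChange`). -/
theorem isBaseChange_ofR : IsBaseChange S (ofR R S V).toLinearMap :=
  IsBaseChange.of_equiv (extBC R S V).symm.toLinearEquiv (fun _ => rfl)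

end ExteriorBaseChange

section Extension

variable {R : Type*} [CommRing R] [Invertible (2 : R)]
variable {S : Type*} [CommRing S] [Algebra R S]
variable {V : Type*} [AddCommGroup V] [Module R V]

/-- Two `S`-linear maps out of `⋀_S (S ⊗ V)` agreeing on the coefficient extension of `⋀_R V`
agree everywhere (the uniqueness half of the universal property of base change). -/
theorem ext_of_ofR {Q : Type*} [AddCommMonoid Q] [Module S Q]
    (g₁ g₂ : ExteriorAlgebra S (S ⊗[R] V) →ₗ[S] Q)
    (h : ∀ a : ExteriorAlgebra R V, g₁ (ofR R S V a) = g₂ (ofR R S V a)) : g₁ = g₂ :=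
  (isBaseChange_ofR (R := R) (S := S) (V := V)).algHom_ext g₁ g₂ h

variable (R S V) in
/-- The `S`-linear extension of an `R`-linear functional `φ : ⋀_R V → R` to `⋀_S (S ⊗ V) → S`. -/
noncomputable def extFun (φ : ExteriorAlgebra R V →ₗ[R] R) :
    ExteriorAlgebra S (S ⊗[R] V) →ₗ[S] S :=
  (isBaseChange_ofR (R := R) (S := S) (V := V)).lift (Algebra.linearMap R S ∘ₗ φ)

/-- `extFun φ (ofR a) = algebraMap R S (φ a)`. -/
theorem extFun_ofR (φ : ExteriorAlgebra R V →ₗ[R] R) (a : ExteriorAlgebra R V) :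
    extFun R S V φ (ofR R S V a) = algebraMap R S (φ a) :=
  (isBaseChange_ofR (R := R) (S := S) (V := V)).lift_eq (Algebra.linearMap R S ∘ₗ φ) a

/-- `ofR` respects the wedge monomials: `ofR (v₁ ∧ ⋯ ∧ vₙ) = (1 ⊗ v₁) ∧ ⋯ ∧ (1 ⊗ vₙ)`. -/
theorem ofR_ιMulti {n : ℕ} (v : Fin n → V) :
    ofR R S V (ExteriorAlgebra.ιMulti R n v) =
      ExteriorAlgebra.ιMulti S n (fun i => (1 : S) ⊗ₜ[R] v i) := by
  rw [ExteriorAlgebra.ιMulti_apply, ExteriorAlgebra.ιMulti_apply, map_list_prod, List.map_ofFn]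
  exact congrArg List.prod (congrArg List.ofFn (funext fun i => ofR_ι (v i)))

/-- `ofR` is graded: it maps `⋀^n_R V` into `⋀^n_S (S ⊗ V)`. -/
theorem ofR_mem_exteriorPower {n : ℕ} {a : ExteriorAlgebra R V} (ha : a ∈ ⋀[R]^n V) :
    ofR R S V a ∈ ⋀[S]^n (S ⊗[R] V) := by
  rw [← ExteriorAlgebra.ιMulti_span_fixedDegree] at ha
  induction ha using Submodule.span_induction with
  | mem x hx =>
    obtain ⟨v, rfl⟩ := hx
    rw [ofR_ιMulti]
    exact ExteriorAlgebra.ιMulti_range S n ⟨_, rfl⟩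
  | zero => simp
  | add x y _ _ hx hy => rw [map_add]; exact Submodule.add_mem _ hx hy
  | smul r x _ hx =>
    rw [map_smul]
    exact Submodule.smul_of_tower_mem _ r hx

end Extension

section GradedTensor

variable (R : Type*) [CommRing R] [Invertible (2 : R)]
variable (S : Type*) [CommRing S] [Algebra R S]
variable (V : Type*) [AddCommGroup V] [Module R V]

/-- The degree grading of `⋀_R V`. -/
abbrev gradR : ℕ → Submodule R (ExteriorAlgebra R V) := fun n => ⋀[R]^n V

/-- The degree grading of `⋀_S (S ⊗ V)`. -/
abbrev gradS : ℕ → Submodule S (ExteriorAlgebra S (S ⊗[R] V)) := fun n => ⋀[S]^n (S ⊗[R] V)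

/-- `⋀_R V` is graded by degree (Mathlib's `ExteriorAlgebra.gradedAlgebra`, made an instance). -/
instance instGradedAlgebraGradR : GradedAlgebra (gradR R V) := ExteriorAlgebra.gradedAlgebra R V
/-- `⋀_S (S ⊗ V)` is graded by degree. -/
instance instGradedAlgebraGradS : GradedAlgebra (gradS R S V) :=
  ExteriorAlgebra.gradedAlgebra S (S ⊗[R] V)

/-- `⋀_R V ᵍ⊗[R] ⋀_R V` (the model of `H^*(B × B, ℚ)`). -/
abbrev TT_R := GradedTensorProduct R (gradR R V) (gradR R V)

/-- `⋀_S (S ⊗ V) ᵍ⊗[S] ⋀_S (S ⊗ V)` (the model of `H^*(B × B, ℂ)`). -/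
abbrev TT_S := GradedTensorProduct S (gradS R S V) (gradS R S V)

/-- The `R`-algebra structure of `TT_S` through `R → S` (not a Mathlib instance; local to this
file). -/
noncomputable instance instAlgebraTT_S : Algebra R (TT_S R S V) :=
  Algebra.compHom (TT_S R S V) (algebraMap R S)

/-- The `R`-structure of `TT_S` factors through `S`. -/
instance instIsScalarTowerTT_S : IsScalarTower R S (TT_S R S V) :=
  IsScalarTower.of_algebraMap_eq fun _ => rfl

variable {R S V}

/-- The Koszul anticommutation of `ofR a ⊗ 1` and `1 ⊗ ofR b` in `TT_S`. -/
theorem anticommutes_ofR :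
    ∀ ⦃i j : ℕ⦄ (a : gradR R V i) (b : gradR R V j),
      ((GradedTensorProduct.includeLeft (gradS R S V) (gradS R S V)).restrictScalars R |>.comp
          (ofR R S V)) a *
        ((GradedTensorProduct.includeRight (gradS R S V) (gradS R S V)).restrictScalars R |>.comp
          (ofR R S V)) b =
      (-1 : ℤˣ) ^ (j * i) •
        (((GradedTensorProduct.includeRight (gradS R S V) (gradS R S V)).restrictScalars R |>.comp
            (ofR R S V)) b *
          ((GradedTensorProduct.includeLeft (gradS R S V) (gradS R S V)).restrictScalars R |>.comp
            (ofR R S V)) a) := by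
  intro i j a b
  simp only [AlgHom.comp_apply, AlgHom.coe_restrictScalars', GradedTensorProduct.includeLeft_apply,
    GradedTensorProduct.includeRight_apply]
  have ha : ofR R S V a ∈ gradS R S V i := ofR_mem_exteriorPower a.2
  have hb : ofR R S V b ∈ gradS R S V j := ofR_mem_exteriorPower b.2
  have h1 := GradedTensorProduct.tmul_coe_mul_coe_tmul (gradS R S V) (gradS R S V)
    (ofR R S V a) (⟨1, SetLike.one_mem_graded _⟩ : gradS R S V 0)
    (⟨1, SetLike.one_mem_graded _⟩ : gradS R S V 0) (ofR R S V b)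
  have h2 := GradedTensorProduct.tmul_coe_mul_coe_tmul (gradS R S V) (gradS R S V)
    (1 : ExteriorAlgebra S (S ⊗[R] V)) (⟨ofR R S V b, hb⟩ : gradS R S V j)
    (⟨ofR R S V a, ha⟩ : gradS R S V i) (1 : ExteriorAlgebra S (S ⊗[R] V))
  simp only [mul_zero, uzpow_zero, one_smul, mul_one, one_mul] at h1 h2
  rw [h1, h2, smul_smul, Int.units_mul_self, one_smul]

variable (R S V) in
/-- The base change `⋀_R V ᵍ⊗[R] ⋀_R V →ₐ[R] ⋀_S (S ⊗ V) ᵍ⊗[S] ⋀_S (S ⊗ V)` of the graded tensor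
product (`pr₁^*` and `pr₂^*` are compatible with the coefficient extension). -/
noncomputable def ofRTT : TT_R R V →ₐ[R] TT_S R S V :=
  GradedTensorProduct.lift (gradR R V) (gradR R V)
    ((GradedTensorProduct.includeLeft (gradS R S V) (gradS R S V)).restrictScalars R |>.comp
      (ofR R S V))
    ((GradedTensorProduct.includeRight (gradS R S V) (gradS R S V)).restrictScalars R |>.comp
      (ofR R S V))
    anticommutes_ofR

/-- `ofRTT (a ᵍ⊗ b) = ofR a ᵍ⊗ ofR b`. -/
theorem ofRTT_tmul (a b : ExteriorAlgebra R V) :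
    ofRTT R S V (a ᵍ⊗ₜ[R] b) = ofR R S V a ᵍ⊗ₜ[S] ofR R S V b := by
  unfold ofRTT
  rw [GradedTensorProduct.lift_tmul]
  simp only [AlgHom.comp_apply, AlgHom.coe_restrictScalars', GradedTensorProduct.includeLeft_apply,
    GradedTensorProduct.includeRight_apply]
  rw [GradedTensorProduct.tmul_one_mul_one_tmul]

/-- `ofRTT (a ᵍ⊗ 1) = ofR a ᵍ⊗ 1` (compatibility with `pr₁^*`). -/
theorem ofRTT_includeLeft (a : ExteriorAlgebra R V) :
    ofRTT R S V (GradedTensorProduct.includeLeft (gradR R V) (gradR R V) a) =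
      GradedTensorProduct.includeLeft (gradS R S V) (gradS R S V) (ofR R S V a) := by
  rw [GradedTensorProduct.includeLeft_apply, GradedTensorProduct.includeLeft_apply, ofRTT_tmul,
    map_one]

/-- `ofRTT (1 ᵍ⊗ b) = 1 ᵍ⊗ ofR b` (compatibility with `pr₂^*`). -/
theorem ofRTT_includeRight (b : ExteriorAlgebra R V) :
    ofRTT R S V (GradedTensorProduct.includeRight (gradR R V) (gradR R V) b) =
      GradedTensorProduct.includeRight (gradS R S V) (gradS R S V) (ofR R S V b) := by
  rw [GradedTensorProduct.includeRight_apply, GradedTensorProduct.includeRight_apply, ofRTT_tmul,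
    map_one]

end GradedTensor

section ProductIntegral

variable {R : Type*} [CommRing R] [Invertible (2 : R)]
variable {S : Type*} [CommRing S] [Algebra R S]
variable {V : Type*} [AddCommGroup V] [Module R V]

variable (R S V) in
/-- The product functional `x ᵍ⊗ y ↦ φ x · φ y` on `TT_S` (Fubini by construction; p5's `II`
pattern). -/
noncomputable def intTT (φ : ExteriorAlgebra S (S ⊗[R] V) →ₗ[S] S) : TT_S R S V →ₗ[S] S :=
  TensorProduct.lift ((LinearMap.mul S S).compl₁₂ φ φ) ∘ₗ
    (GradedTensorProduct.of S (gradS R S V) (gradS R S V)).symm.toLinearMap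

omit [Invertible (2 : R)] in
/-- `intTT φ (x ᵍ⊗ y) = φ x * φ y`. -/
theorem intTT_tmul (φ : ExteriorAlgebra S (S ⊗[R] V) →ₗ[S] S)
    (x y : ExteriorAlgebra S (S ⊗[R] V)) :
    intTT R S V φ (x ᵍ⊗ₜ[S] y) = φ x * φ y := by
  simp only [intTT, LinearMap.comp_apply, LinearEquiv.coe_coe, GradedTensorProduct.of_symm_of,
    TensorProduct.lift.tmul, LinearMap.compl₁₂_apply, LinearMap.mul_apply']

/-- A functional `ψ` on `TT_R` satisfying Fubini against `φ` (`ψ (a ᵍ⊗ b) = φ a · φ b`) is the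
restriction of `intTT (extFun φ)` along the base change `ofRTT`. -/
theorem intTT_ofRTT (φ : ExteriorAlgebra R V →ₗ[R] R) (ψ : TT_R R V →ₗ[R] R)
    (hψ : ∀ a b : ExteriorAlgebra R V, ψ (a ᵍ⊗ₜ[R] b) = φ a * φ b) (x : TT_R R V) :
    intTT R S V (extFun R S V φ) (ofRTT R S V x) = algebraMap R S (ψ x) := by
  have key : (intTT R S V (extFun R S V φ)).restrictScalars R ∘ₗ (ofRTT R S V).toLinearMap =
      (Algebra.linearMap R S) ∘ₗ ψ := by
    apply GradedTensorProduct.hom_ext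
    apply TensorProduct.ext'
    intro a b
    simp only [LinearMap.comp_apply, LinearEquiv.coe_coe, LinearMap.coe_restrictScalars,
      AlgHom.toLinearMap_apply, Algebra.linearMap_apply]
    change intTT R S V (extFun R S V φ) (ofRTT R S V (a ᵍ⊗ₜ[R] b)) = algebraMap R S (ψ (a ᵍ⊗ₜ[R] b))
    rw [ofRTT_tmul, intTT_tmul, extFun_ofR, extFun_ofR, hψ, map_mul]
  have := congrArg (fun f => f x) key
  simpa using this

end ProductIntegral

section Coproduct

variable {R : Type*} [CommRing R] [Invertible (2 : R)]
variable {S : Type*} [CommRing S] [Algebra R S]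
variable {V : Type*} [AddCommGroup V] [Module R V]

omit [Invertible (2 : R)] in
/-- The square-zero condition for `w ↦ ι w ⊗ 1 + 1 ⊗ ι w` in a graded tensor product of exterior
algebras (Koszul sign in degree one). -/
theorem coproductMapS_sq (w : S ⊗[R] V) :
    (GradedTensorProduct.includeLeft (gradS R S V) (gradS R S V) (ExteriorAlgebra.ι S w) +
        GradedTensorProduct.includeRight (gradS R S V) (gradS R S V) (ExteriorAlgebra.ι S w)) *
      (GradedTensorProduct.includeLeft (gradS R S V) (gradS R S V) (ExteriorAlgebra.ι S w) +
        GradedTensorProduct.includeRight (gradS R S V) (gradS R S V) (ExteriorAlgebra.ι S w)) =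
      0 := by
  have hw : ExteriorAlgebra.ι S w ∈ gradS R S V 1 :=
    ExteriorAlgebra.ιMulti_range S 1 ⟨fun _ => w, by simp [ExteriorAlgebra.ιMulti_apply]⟩
  set x := ExteriorAlgebra.ι S w with hx
  have hsq : x * x = 0 := ExteriorAlgebra.ι_sq_zero w
  simp only [GradedTensorProduct.includeLeft_apply, GradedTensorProduct.includeRight_apply]
  have h1 := GradedTensorProduct.tmul_coe_mul_coe_tmul (gradS R S V) (gradS R S V)
    x (⟨1, SetLike.one_mem_graded _⟩ : gradS R S V 0) (⟨1, SetLike.one_mem_graded _⟩ : gradS R S V 0) x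
  have h2 := GradedTensorProduct.tmul_coe_mul_coe_tmul (gradS R S V) (gradS R S V)
    (1 : ExteriorAlgebra S (S ⊗[R] V)) (⟨x, hw⟩ : gradS R S V 1) (⟨x, hw⟩ : gradS R S V 1)
    (1 : ExteriorAlgebra S (S ⊗[R] V))
  have h3 := GradedTensorProduct.tmul_coe_mul_coe_tmul (gradS R S V) (gradS R S V)
    x (⟨1, SetLike.one_mem_graded _⟩ : gradS R S V 0) (⟨x, hw⟩ : gradS R S V 1)
    (1 : ExteriorAlgebra S (S ⊗[R] V))
  have h4 := GradedTensorProduct.tmul_coe_mul_coe_tmul (gradS R S V) (gradS R S V)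
    (1 : ExteriorAlgebra S (S ⊗[R] V)) (⟨x, hw⟩ : gradS R S V 1) (⟨1, SetLike.one_mem_graded _⟩ : gradS R S V 0) x
  simp only [mul_zero, uzpow_zero, one_smul, mul_one, one_mul, hsq] at h1 h2 h3 h4
  rw [add_mul, mul_add, mul_add, h1, h2, h3, h4]
  have hz1 : (GradedTensorProduct.tmul S (0 : ExteriorAlgebra S (S ⊗[R] V))
      (1 : ExteriorAlgebra S (S ⊗[R] V)) : TT_S R S V) = 0 := by
    simp [GradedTensorProduct.tmul]
  have hz2 : (GradedTensorProduct.tmul S (1 : ExteriorAlgebra S (S ⊗[R] V))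
      (0 : ExteriorAlgebra S (S ⊗[R] V)) : TT_S R S V) = 0 := by
    simp [GradedTensorProduct.tmul]
  rw [hz1, hz2, uzpow_one, Units.neg_smul, one_smul]
  abel


variable (R S V) in
/-- The coproduct `Δ_S : ⋀_S (S ⊗ V) →ₐ[S] TT_S`, `ι w ↦ ι w ⊗ 1 + 1 ⊗ ι w` — the model of
`m^*` along the addition of the torus, on the complex carrier (p5's `WeilCoproduct.cop` pattern). -/
noncomputable def copS : ExteriorAlgebra S (S ⊗[R] V) →ₐ[S] TT_S R S V :=
  ExteriorAlgebra.lift S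
    ⟨(GradedTensorProduct.includeLeft (gradS R S V) (gradS R S V)).toLinearMap ∘ₗ
        ExteriorAlgebra.ι S +
      (GradedTensorProduct.includeRight (gradS R S V) (gradS R S V)).toLinearMap ∘ₗ
        ExteriorAlgebra.ι S,
      fun w => by
        simp only [LinearMap.add_apply, LinearMap.comp_apply, AlgHom.toLinearMap_apply]
        exact coproductMapS_sq w⟩

omit [Invertible (2 : R)] in
/-- `Δ_S (ι w) = ι w ⊗ 1 + 1 ⊗ ι w`. -/
theorem copS_ι (w : S ⊗[R] V) :
    copS R S V (ExteriorAlgebra.ι S w) =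
      GradedTensorProduct.includeLeft (gradS R S V) (gradS R S V) (ExteriorAlgebra.ι S w) +
        GradedTensorProduct.includeRight (gradS R S V) (gradS R S V) (ExteriorAlgebra.ι S w) := by
  unfold copS
  rw [ExteriorAlgebra.lift_ι_apply]
  simp only [LinearMap.add_apply, LinearMap.comp_apply, AlgHom.toLinearMap_apply]

/-- A rational coproduct `Δ_R : ⋀_R V →ₐ[R] TT_R` with `Δ_R (ι v) = ι v ⊗ 1 + 1 ⊗ ι v` is carried
by the base changes to `Δ_S`: `Δ_S ∘ ofR = ofRTT ∘ Δ_R`. -/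
theorem copS_comp_ofR (copR : ExteriorAlgebra R V →ₐ[R] TT_R R V)
    (hcop : ∀ v : V, copR (ExteriorAlgebra.ι R v) =
      GradedTensorProduct.includeLeft (gradR R V) (gradR R V) (ExteriorAlgebra.ι R v) +
        GradedTensorProduct.includeRight (gradR R V) (gradR R V) (ExteriorAlgebra.ι R v)) :
    ((copS R S V).restrictScalars R).comp (ofR R S V) = (ofRTT R S V).comp copR := by
  apply ExteriorAlgebra.hom_ext
  refine LinearMap.ext fun v => ?_
  simp only [LinearMap.comp_apply, AlgHom.toLinearMap_apply, AlgHom.comp_apply,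
    AlgHom.coe_restrictScalars', ofR_ι, copS_ι, hcop, map_add, ofRTT_includeLeft,
    ofRTT_includeRight]

/-- Pointwise form of `copS_comp_ofR`. -/
theorem copS_ofR (copR : ExteriorAlgebra R V →ₐ[R] TT_R R V)
    (hcop : ∀ v : V, copR (ExteriorAlgebra.ι R v) =
      GradedTensorProduct.includeLeft (gradR R V) (gradR R V) (ExteriorAlgebra.ι R v) +
        GradedTensorProduct.includeRight (gradR R V) (gradR R V) (ExteriorAlgebra.ι R v))
    (a : ExteriorAlgebra R V) :
    copS R S V (ofR R S V a) = ofRTT R S V (copR a) := by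
  have := congrArg (fun f => f a) (copS_comp_ofR (S := S) copR hcop)
  simpa using this

end Coproduct

end Summit.Ventures.HodgeRepro2.T6.A3ExtBC
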